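import Mathlib
import HarnessLib.Audit
import Summits.PneNP.PneNP.Theorems.PstarCrossBlind
import Summits.PneNP.PneNP.Theorems.PstarCoupled

/-!
# The blind free cross gate IS the NOR-coupled datum: `CoupledThree → TerminalFiveCross1Blind` (ROUND-25, memo §14.33 (B) / §14.34; p3's first prover item of `PstarCoupled`)

FRONTIER range-avoidance ladder, rung F-N3, ROUND 25 (cell `pnp-ideate`, planner memo `r24/CORE-BOUND-NOTES.md` §14.33–§14.34; restricted-model proof complexity —
nothing here bears on `P` versus `NP`).

With the OR shape of `PstarCrossBlind` (`w₁ = A + (x_p ∨ x_q)`, `A := w₁` minus the gate and the two linear reads, blind to the four privates) the Terminal datum on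
`J₀` is the datum `CoupledThree` of `PstarCoupled` on `J₀ ∖ {e_p, e_q}`:

* `bit_gval_or` — `w₁(x) = A(x) + (x_p ∨ x_q)`;
* `eval_iff_sform` — a pure output `e` holds at `z` iff its AND monomial equals `sform I y e z`;
* `cross1BlindOr_of_coupledThree : CoupledThree → TerminalFiveCross1BlindOr` — (i) every solution of `J₀ ∖ {e_p, e_q}` with `w₂ = t₂` extends INTO `Z` by setting
  each deleted chord's private pair to `(s, s)` (`s` its XOR side), where `x_p ∨ x_q ≡ 1` gives `s_p ∨ s_q` and `w₁ ≠ t₁` gives `A = t₁`; (ii) the Terminal witness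
  of `f` has `w₁ = t₁`, so `A = t₁` there forces `x_p = x_q = 0`, whence `s_p = s_q = 0` (both chords hold); (iii) the free points (`x_p = 0`, resp. `x_q = 0`, on `Z`)
  have `s_p = 0`, resp. `s_q = 0`;
* **`terminalFiveCross1Blind_of_coupledThree : CoupledThree → TerminalFiveCross1Blind`.**
-/

set_option linter.dupNamespace false -- `Summit.PneNP.PneNP.…`: summit = sub-problem name (D-0017 single-conjunct layout)

open Finset Literature.Computability.Complexity
open Summit.PneNP.PneNP.Theorems.PstarFibrePolys (bit bit_injective bit_xor)
open Summit.PneNP.PneNP.Theorems.PstarTyped (Typed)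
open Summit.PneNP.PneNP.Theorems.PstarSALevel (varSet bdry BoundaryExpanding SimpleOverlap)
open Summit.PneNP.PneNP.Theorems.PstarGapPeeling (not_mem_varSet_of_private eval_pure)
open Summit.PneNP.PneNP.Theorems.PstarCentreFree (vars_mem_varSet)
open Summit.PneNP.PneNP.Theorems.PstarGapOneAll (gval)
open Summit.PneNP.PneNP.Theorems.PstarGConstraint (bit_gval gval_update_of_forall_ne)
open Summit.PneNP.PneNP.Theorems.PstarCoreBound (XorClosed)
open Summit.PneNP.PneNP.Theorems.PstarChordRepair (IsChord)
open Summit.PneNP.PneNP.Theorems.PstarChordBridgeCotree (Peelable)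
open Summit.PneNP.PneNP.Theorems.PstarChordBridgeTools (privs mem_privs)
open Summit.PneNP.PneNP.Theorems.PstarCoreBoundTargets (Terminal)
open Summit.PneNP.PneNP.Theorems.PstarUnion (SatPair)
open Summit.PneNP.PneNP.Theorems.PstarUnionCaseB (setPair_two setPair_of_ne eval_setPair_of_ne)
open Summit.PneNP.PneNP.Theorems.PstarChordReadCoupledSplit (gval_erase_mono)
open Summit.PneNP.PneNP.Theorems.PstarCross (CrossGate)
open Summit.PneNP.PneNP.Theorems.PstarCross2 (touchedBy TerminalFiveCross1Blind)
open Summit.PneNP.PneNP.Theorems.PstarCrossBlind (TerminalFiveCross1BlindOr terminalFiveCross1Blind_of_or)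
open Summit.PneNP.PneNP.Theorems.PstarCoupled (sform CoupledThree)

namespace Summit.PneNP.PneNP.Theorems.PstarCrossCoupled

variable {n m : ℕ}

/-! ## Two identities -/

/-- **`w₁ = A + (x_p ∨ x_q)`**: removing the gate `g₀ = x_p x_q` and the two linear reads `x_p, x_q` from `w₁`. -/
theorem bit_gval_or (I : LocalMap 4 n m) (w₁ : Finset (Fin n) × Finset (Fin m) × Bool) {g₀ : Fin m} (hg₀ : g₀ ∈ w₁.2.1)
    (hp : I.vars g₀ 2 ∈ w₁.1) (hq : I.vars g₀ 3 ∈ w₁.1) (hpq : I.vars g₀ 2 ≠ I.vars g₀ 3) (x : Fin n → Bool) :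
    bit (gval I w₁.1 w₁.2.1 x) = bit (gval I ((w₁.1.erase (I.vars g₀ 2)).erase (I.vars g₀ 3)) (w₁.2.1.erase g₀) x) +
      bit (x (I.vars g₀ 2) || x (I.vars g₀ 3)) := by
  classical
  have hq' : I.vars g₀ 3 ∈ w₁.1.erase (I.vars g₀ 2) := mem_erase.2 ⟨hpq.symm, hq⟩
  rw [gval_erase_mono I w₁.1 w₁.2.1 g₀ x, decide_eq_true hg₀, Bool.true_and, bit_xor, bit_gval, bit_gval,
    ← sum_erase_add _ _ hp, ← sum_erase_add _ _ hq']
  have e : ∀ a b : Bool, bit (a && b) = bit a * bit b ∧ bit (a || b) = bit a + bit b + bit a * bit b := by decide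
  rw [(e _ _).1, (e _ _).2]
  ring

/-- **A pure output holds iff its AND monomial equals its XOR side `sform`.** -/
theorem eval_iff_sform (I : LocalMap 4 n m) (hI : I.IsPure xorAndPred) (y : Fin m → Bool) (e : Fin m) (z : Fin n → Bool) :
    I.eval z e = y e ↔ (z (I.vars e 2) && z (I.vars e 3)) = sform I y e z := by
  unfold sform
  rw [eval_pure I hI]
  cases z (I.vars e 0) <;> cases z (I.vars e 1) <;> cases (z (I.vars e 2) && z (I.vars e 3)) <;> cases y e <;> decide

/-- Setting a chord's private pair does not change its XOR side. -/
theorem sform_setPair (I : LocalMap 4 n m) (hI : I.IsPure xorAndPred) (y : Fin m → Bool) (e : Fin m) (x : Fin n → Bool) (a b : Bool) :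
    sform I y e (Function.update (Function.update x (I.vars e 2) a) (I.vars e 3) b) = sform I y e x := by
  have hinj := hI.2 e
  have h02 : I.vars e 0 ≠ I.vars e 2 := fun h => absurd (hinj h) (by decide)
  have h03 : I.vars e 0 ≠ I.vars e 3 := fun h => absurd (hinj h) (by decide)
  have h12 : I.vars e 1 ≠ I.vars e 2 := fun h => absurd (hinj h) (by decide)
  have h13 : I.vars e 1 ≠ I.vars e 3 := fun h => absurd (hinj h) (by decide)
  unfold sform
  rw [setPair_of_ne I e x a b h02 h03, setPair_of_ne I e x a b h12 h13]

/-- The XOR side of `e'` does not see the private pair of another output `e` (typed instance: AND slots are never XOR slots). -/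
theorem sform_setPair_of_typed (I : LocalMap 4 n m) (hT : Typed I) (y : Fin m → Bool) (e e' : Fin m) (x : Fin n → Bool) (a b : Bool) :
    sform I y e' (Function.update (Function.update x (I.vars e 2) a) (I.vars e 3) b) = sform I y e' x := by
  unfold sform
  rw [setPair_of_ne I e x a b (hT e' e 0 2 (by decide) (by decide)) (hT e' e 0 3 (by decide) (by decide)),
    setPair_of_ne I e x a b (hT e' e 1 2 (by decide) (by decide)) (hT e' e 1 3 (by decide) (by decide))]

/-! ## The reduction -/

/-- **`CoupledThree → TerminalFiveCross1BlindOr`.** -/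
theorem cross1BlindOr_of_coupledThree (hC : CoupledThree) : TerminalFiveCross1BlindOr := by
  intro n m r I hI hT hS hB y J₀ w₁ w₂ ht F hF hP hmax hch g₀ hg₀ hcg hun h2 h3 hbl hpC hqC hmates hZor
  classical
  obtain ⟨hne0, hX, hJr, hd₁, hd₂, hrad, hT3, hM0⟩ := id ht
  have hg₀J : g₀ ∉ J₀ := fun h => Finset.disjoint_left.1 hd₁ h hg₀
  have hpq : I.vars g₀ 2 ≠ I.vars g₀ 3 := fun h => absurd (hI.2 g₀ h) (by decide)
  -- the two chords and their mates
  obtain ⟨e_p, hep, hepv⟩ := (mem_privs I).1 hcg.1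
  obtain ⟨e_q, heq, heqv⟩ := (mem_privs I).1 hcg.2
  have hepJ : e_p ∈ J₀ := (mem_sdiff.1 hep).1
  have heqJ : e_q ∈ J₀ := (mem_sdiff.1 heq).1
  have hvs : ∀ {e : Fin m} {w : Fin n}, (I.vars e 2 = w ∨ I.vars e 3 = w) → w ∈ varSet I e := by
    rintro e w (h | h) <;> rw [← h] <;> exact vars_mem_varSet I e _
  have owner : ∀ {e e' : Fin m}, e ∈ J₀ \ F → e' ∈ J₀ \ F → ∀ {u : Fin n}, u ∈ varSet I e → (I.vars e' 2 = u ∨ I.vars e' 3 = u) → e = e' := by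
    intro e e' he he' u hu hu'
    by_contra hne
    rcases hu' with h' | h'
    · exact not_mem_varSet_of_private I (mem_sdiff.1 he').1 (mem_sdiff.1 he).1 hne (hch e' he').1 (vars_mem_varSet I e' 2) (h' ▸ hu)
    · exact not_mem_varSet_of_private I (mem_sdiff.1 he').1 (mem_sdiff.1 he).1 hne (hch e' he').2 (vars_mem_varSet I e' 3) (h' ▸ hu)
  have hne : e_p ≠ e_q := by
    intro hee
    have hsub : ({(I.vars g₀ 2), (I.vars g₀ 3)} : Finset (Fin n)) ⊆ varSet I g₀ ∩ varSet I e_p := by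
      intro w hw
      rw [mem_insert, mem_singleton] at hw
      rw [mem_inter]
      rcases hw with rfl | rfl
      · exact ⟨vars_mem_varSet I g₀ 2, hvs hepv⟩
      · exact ⟨vars_mem_varSet I g₀ 3, hee ▸ hvs heqv⟩
    have hcard := (card_le_card hsub).trans (hS g₀ e_p (fun h => hg₀J (h ▸ hepJ)))
    rw [card_pair hpq] at hcard
    omega
  have htouch : ∀ {e : Fin m}, e ∈ J₀ \ F → (I.vars e 2 = I.vars g₀ 2 ∨ I.vars e 3 = I.vars g₀ 2) ∨ (I.vars e 2 = I.vars g₀ 3 ∨ I.vars e 3 = I.vars g₀ 3) →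
      e ∈ touchedBy I J₀ F g₀ := by
    intro e he h
    unfold touchedBy
    refine mem_filter.2 ⟨he, ?_⟩
    rcases h with (h | h) | (h | h)
    · exact Or.inl h.symm
    · exact Or.inr (Or.inl h.symm)
    · exact Or.inr (Or.inr (Or.inl h.symm))
    · exact Or.inr (Or.inr (Or.inr h.symm))
  have htp := htouch hep (Or.inl hepv)
  have htq := htouch heq (Or.inr heqv)
  -- every private slot of `e_p`, `e_q` is unread by `w₁` minus `{p, q}` and by `w₂`
  have slot_cases : ∀ s : Fin 4, 2 ≤ s.val → s = 2 ∨ s = 3 := by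
    intro s hs
    rcases s with ⟨_ | _ | _ | _ | k, hk⟩
    · exact absurd hs (by simp)
    · exact absurd hs (by simp)
    · exact Or.inl rfl
    · exact Or.inr rfl
    · omega
  have unreadA : ∀ {e : Fin m}, e ∈ touchedBy I J₀ F g₀ → ∀ s : Fin 4, 2 ≤ s.val →
      I.vars e s ∉ (w₁.1.erase (I.vars g₀ 2)).erase (I.vars g₀ 3) := by
    intro e he s hs hmem
    have h1 := mem_erase.1 hmem
    have h2 := mem_erase.1 h1.2
    exact hmates e he s hs h2.1 h1.1 h2.2
  have blindW : ∀ {e : Fin m}, e ∈ touchedBy I J₀ F g₀ → ∀ s : Fin 4, 2 ≤ s.val → I.vars e s ∉ w₂.1 := by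
    intro e he s hs
    rcases slot_cases s hs with rfl | rfl
    · exact (hbl e he).1
    · exact (hbl e he).2
  have privOf : ∀ {e : Fin m}, e ∈ J₀ \ F → ∀ s : Fin 4, 2 ≤ s.val → I.vars e s ∈ privs I (J₀ \ F) := by
    intro e he s hs
    rcases slot_cases s hs with rfl | rfl
    · exact (mem_privs I).2 ⟨e, he, Or.inl rfl⟩
    · exact (mem_privs I).2 ⟨e, he, Or.inr rfl⟩
  -- the clean member `A`
  have hg₀2 : g₀ ∉ w₂.2.1 := fun h => (hun g₀ (mem_union_right _ h) _ hcg.1).1 rfl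
  -- invariance of `A` and `w₂` under resetting a touched chord's pair
  have invA : ∀ {e : Fin m}, e ∈ J₀ \ F → e ∈ touchedBy I J₀ F g₀ → ∀ (x : Fin n → Bool) (a b : Bool),
      gval I ((w₁.1.erase (I.vars g₀ 2)).erase (I.vars g₀ 3)) (w₁.2.1.erase g₀) (Function.update (Function.update x (I.vars e 2) a) (I.vars e 3) b) =
        gval I ((w₁.1.erase (I.vars g₀ 2)).erase (I.vars g₀ 3)) (w₁.2.1.erase g₀) x ∧
      gval I w₂.1 w₂.2.1 (Function.update (Function.update x (I.vars e 2) a) (I.vars e 3) b) = gval I w₂.1 w₂.2.1 x := by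
    intro e heF he x a b
    have c2 := privOf heF 2 (by decide)
    have c3 := privOf heF 3 (by decide)
    constructor
    · rw [gval_update_of_forall_ne I _ (unreadA he 3 (by decide)) (fun g hg => hun g (mem_union_left _ hg) _ c3),
        gval_update_of_forall_ne I _ (unreadA he 2 (by decide)) (fun g hg => hun g (mem_union_left _ hg) _ c2)]
    · rw [gval_update_of_forall_ne I _ (blindW he 3 (by decide)) (fun g hg => hun g (mem_union_right _ hg) _ c3),
        gval_update_of_forall_ne I _ (blindW he 2 (by decide)) (fun g hg => hun g (mem_union_right _ hg) _ c2)]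
  -- the gate variables sit in the pairs
  have gateval : ∀ {e : Fin m} {w : Fin n}, (I.vars e 2 = w ∨ I.vars e 3 = w) → ∀ (x : Fin n → Bool) (s : Bool),
      Function.update (Function.update x (I.vars e 2) s) (I.vars e 3) s w = s := by
    rintro e w (h | h) x s
    · rw [← h]; exact (setPair_two I hI e x s s).1
    · rw [← h]; exact (setPair_two I hI e x s s).2
  -- a solution has both chords' monomials equal to their XOR sides
  have chord_s : ∀ {e : Fin m}, e ∈ J₀ → ∀ {z : Fin n → Bool}, (∀ j ∈ J₀, I.eval z j = y j) → ∀ {w : Fin n}, (I.vars e 2 = w ∨ I.vars e 3 = w) →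
      z w = false → sform I y e z = false := by
    intro e he z hz w hw hzw
    have h := (eval_iff_sform I hI y e z).1 (hz e he)
    rcases hw with h' | h'
    · rw [h', hzw, Bool.false_and] at h; exact h.symm
    · rw [h', hzw, Bool.and_false] at h; exact h.symm
  refine hC n m r I hI hT hS hB y J₀ F e_p e_q (((w₁.1.erase (I.vars g₀ 2)).erase (I.vars g₀ 3)), w₁.2.1.erase g₀, w₁.2.2) w₂ hX hJr
    (hd₁.mono_right (erase_subset _ _)) hd₂ ?_ hF hP hmax hch hep heq hne ?_ ?_ ?_ ?_ ?_ ?_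
  · -- radius slack: the gate is gone
    have hsub : J₀ ∪ w₁.2.1.erase g₀ ∪ w₂.2.1 ⊆ (J₀ ∪ w₁.2.1 ∪ w₂.2.1).erase g₀ := by
      intro j hj
      rw [mem_erase]
      rcases mem_union.1 hj with hj | hj
      · rcases mem_union.1 hj with hj | hj
        · exact ⟨fun h => hg₀J (h ▸ hj), mem_union_left _ (mem_union_left _ hj)⟩
        · exact ⟨(mem_erase.1 hj).1, mem_union_left _ (mem_union_right _ (mem_erase.1 hj).2)⟩
      · exact ⟨fun h => hg₀2 (h ▸ hj), mem_union_right _ hj⟩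
    have hmem : g₀ ∈ J₀ ∪ w₁.2.1 ∪ w₂.2.1 := mem_union_left _ (mem_union_right _ hg₀)
    exact lt_of_le_of_lt (card_le_card hsub) (lt_of_lt_of_le (card_erase_lt_of_mem hmem) hrad)
  · -- hun for the clean members
    intro g hg v hv
    exact hun g hg v hv
  · -- blindness of `A` and `w₂` on the two chords
    intro e he
    rw [mem_insert, mem_singleton] at he
    have he' : e ∈ touchedBy I J₀ F g₀ := by rcases he with rfl | rfl; exact htp; exact htq
    exact ⟨unreadA he' 2 (by decide), unreadA he' 3 (by decide), blindW he' 2 (by decide), blindW he' 3 (by decide)⟩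
  · -- (i) implication + coupling on `J₀ ∖ {e_p, e_q}`
    intro x hxJ hxw
    -- extend into `Z`: set each chord's pair to `(s, s)`
    set s₁ := sform I y e_p x with hs₁
    set x₁ : Fin n → Bool := Function.update (Function.update x (I.vars e_p 2) s₁) (I.vars e_p 3) s₁ with hx₁
    set s₂ := sform I y e_q x₁ with hs₂
    set x₂ : Fin n → Bool := Function.update (Function.update x₁ (I.vars e_q 2) s₂) (I.vars e_q 3) s₂ with hx₂
    have hs₂x : s₂ = sform I y e_q x := by rw [hs₂, hx₁, sform_setPair_of_typed I hT]
    have hx₁J : ∀ j ∈ J₀, j ≠ e_q → I.eval x₁ j = y j := by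
      intro j hj hjq
      by_cases hjp : j = e_p
      · subst hjp
        rw [eval_iff_sform I hI, hx₁, (setPair_two I hI j x s₁ s₁).1, (setPair_two I hI j x s₁ s₁).2, sform_setPair I hI, Bool.and_self]
      · rw [hx₁, eval_setPair_of_ne I hepJ (hch e_p hep) x s₁ s₁ hj hjp]
        exact hxJ j (mem_erase.2 ⟨hjq, mem_erase.2 ⟨hjp, hj⟩⟩)
    have hx₂J : ∀ j ∈ J₀, I.eval x₂ j = y j := by
      intro j hj
      by_cases hjq : j = e_q
      · subst hjq
        rw [eval_iff_sform I hI, hx₂, (setPair_two I hI j x₁ s₂ s₂).1, (setPair_two I hI j x₁ s₂ s₂).2, sform_setPair I hI, Bool.and_self]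
      · rw [hx₂, eval_setPair_of_ne I heqJ (hch e_q heq) x₁ s₂ s₂ hj hjq]
        exact hx₁J j hj hjq
    have hA₂ := (invA hep htp x s₁ s₁).1
    have hW₁ := (invA hep htp x s₁ s₁).2
    have hA₃ := (invA heq htq x₁ s₂ s₂).1
    have hW₂ := (invA heq htq x₁ s₂ s₂).2
    rw [← hx₁] at hA₂ hW₁
    rw [← hx₂] at hA₃ hW₂
    have hx₂w : gval I w₂.1 w₂.2.1 x₂ = w₂.2.2 := by rw [hW₂, hW₁]; exact hxw
    -- the gate variables at `x₂`
    have hx₂p : x₂ (I.vars g₀ 2) = s₁ := by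
      have hne2 : I.vars g₀ 2 ≠ I.vars e_q 2 := fun h => hne (owner hep heq (hvs hepv) (Or.inl h.symm))
      have hne3 : I.vars g₀ 2 ≠ I.vars e_q 3 := fun h => hne (owner hep heq (hvs hepv) (Or.inr h.symm))
      rw [hx₂, setPair_of_ne I e_q x₁ s₂ s₂ hne2 hne3, hx₁, gateval hepv]
    have hx₂q : x₂ (I.vars g₀ 3) = s₂ := by rw [hx₂, gateval heqv]
    -- the coupling from `Z ⊆ {x_p ∨ x_q}`, and `A = t₁` from `w₁ ≠ t₁`
    have hor : (s₁ || s₂) = true := by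
      rcases hZor x₂ hx₂J hx₂w with h | h
      · rw [← hx₂p, h, Bool.true_or]
      · rw [← hx₂q, h, Bool.or_true]
    constructor
    · have hne1 : gval I w₁.1 w₁.2.1 x₂ ≠ w₁.2.2 := fun h => hT3 ⟨x₂, hx₂J, h, hx₂w⟩
      have hb := bit_gval_or I w₁ hg₀ hpC hqC hpq x₂
      rw [hx₂p, hx₂q, hor, hA₃, hA₂] at hb
      apply bit_injective
      have e : ∀ a t : Bool, a ≠ t → bit a = bit (gval I ((w₁.1.erase (I.vars g₀ 2)).erase (I.vars g₀ 3)) (w₁.2.1.erase g₀) x) + bit true →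
          bit (gval I ((w₁.1.erase (I.vars g₀ 2)).erase (I.vars g₀ 3)) (w₁.2.1.erase g₀) x) = bit t := by
        intro a t hat h
        revert hat h
        generalize gval I ((w₁.1.erase (I.vars g₀ 2)).erase (I.vars g₀ 3)) (w₁.2.1.erase g₀) x = c
        cases a <;> cases t <;> cases c <;> simp [bit]
      exact e _ _ hne1 hb
    · rw [← hs₂x]
      revert hor; cases s₁ <;> cases s₂ <;> simp
  · -- (ii) minimality at every `f`
    intro f hf
    have hfJ : f ∈ J₀ := (mem_erase.1 (mem_erase.1 hf).2).2
    have hfq : f ≠ e_q := (mem_erase.1 hf).1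
    have hfp : f ≠ e_p := (mem_erase.1 (mem_erase.1 hf).2).1
    obtain ⟨x, hxJ, hx1, hx2⟩ := hM0 f hfJ
    refine ⟨x, fun j hj => hxJ j (mem_erase.2 ⟨(mem_erase.1 hj).1, (mem_erase.1 (mem_erase.1 (mem_erase.1 hj).2).2).2⟩), hx2, ?_⟩
    rintro ⟨hA, hs⟩
    -- `w₁ = t₁` and `A = t₁` force the gate corner, hence both XOR sides are `0`
    have hb := bit_gval_or I w₁ hg₀ hpC hqC hpq x
    rw [hx1, hA] at hb
    have hor : (x (I.vars g₀ 2) || x (I.vars g₀ 3)) = false := by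
      revert hb
      generalize w₁.2.2 = t
      cases t <;> cases (x (I.vars g₀ 2) || x (I.vars g₀ 3)) <;> simp [bit]
    rw [Bool.or_eq_false_iff] at hor
    have hep' : e_p ∈ J₀.erase f := mem_erase.2 ⟨Ne.symm hfp, hepJ⟩
    have heq' : e_q ∈ J₀.erase f := mem_erase.2 ⟨Ne.symm hfq, heqJ⟩
    have hsol' : ∀ j ∈ J₀.erase f, I.eval x j = y j := hxJ
    have s1 : sform I y e_p x = false := by
      have h := (eval_iff_sform I hI y e_p x).1 (hsol' e_p hep')
      rcases hepv with h' | h'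
      · rw [h', hor.1, Bool.false_and] at h; exact h.symm
      · rw [h', hor.1, Bool.and_false] at h; exact h.symm
    have s2 : sform I y e_q x = false := by
      have h := (eval_iff_sform I hI y e_q x).1 (hsol' e_q heq')
      rcases heqv with h' | h'
      · rw [h', hor.2, Bool.false_and] at h; exact h.symm
      · rw [h', hor.2, Bool.and_false] at h; exact h.symm
    rw [s1, s2] at hs
    simp at hs
  · -- (iii) `s_p = 0` is met: the free point with `x_p = 0`
    obtain ⟨z, hzJ, hz0, hzw⟩ := h2 false
    have hzp : z (I.vars g₀ 2) = false := by
      have h : gval I {I.vars g₀ 2} ∅ z = false := hz0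
      rwa [PstarChordReadShared.gval_singleton] at h
    exact ⟨z, fun j hj => hzJ j (mem_erase.1 (mem_erase.1 hj).2).2, hzw, chord_s hepJ hzJ hepv hzp⟩
  · obtain ⟨z, hzJ, hz0, hzw⟩ := h3 false
    have hzq : z (I.vars g₀ 3) = false := by
      have h : gval I {I.vars g₀ 3} ∅ z = false := hz0
      rwa [PstarChordReadShared.gval_singleton] at h
    exact ⟨z, fun j hj => hzJ j (mem_erase.1 (mem_erase.1 hj).2).2, hzw, chord_s heqJ hzJ heqv hzq⟩

/-- **The blind free cross gate reduces to the NOR-coupled datum: `CoupledThree → TerminalFiveCross1Blind`.** -/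
theorem terminalFiveCross1Blind_of_coupledThree (hC : CoupledThree) : TerminalFiveCross1Blind :=
  terminalFiveCross1Blind_of_or (cross1BlindOr_of_coupledThree hC)

end Summit.PneNP.PneNP.Theorems.PstarCrossCoupled
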